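import Summits.KontsevichZagierPeriods.Zeta5Search.Certificates.PolyKronecker6Slice

/-!
# Polynomial identity testing in the kernel — variable PERMUTATION before slicing (cell `pub-zeta5`, certifier `cert-2`)

HONEST FRAMING: systematic search; recurrence certificates; no irrationality claim unless certified.

The cost of a reflected Kronecker evaluation is governed by the sizes of ALL intermediate values (the kernel keeps them):
a data polynomial with thousands of monomials must sit on the variables with the SMALLEST strides, and the variable that only
occurs in a few linear factors (here `t`) on the LARGEST stride.  `PolyKronecker6`/`PolyKronecker6Slice` fix the strides by
variable index (`v₀` largest, `v₅ = 1`) and slice `v₅`; this file provides the permutation `σAT` (swap `v₀ ↔ v₅`) with its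
semantics, and the bookkeeping lemma `varsLT_substs_of` (variables stay `< N` under a substitution by expressions with
variables `< N`), so that an identity stated in the order `[a,b,e,f,g,t]` can be CHECKED in the order `[t,b,e,f,g,a]` and
sliced in `a`.  General tooling; no named facts.
-/

namespace Summit.KontsevichZagierPeriods.Zeta5Search.Certificates

namespace PolyReflect

open Lean.Grind.CommRing (Expr Var)

/-- The transposition `v₀ ↔ v₅` as a substitution. -/
def σAT (k : ℕ) : Expr := if k = 0 then .var 5 else if k = 5 then .var 0 else .var k

/-- Semantics of the transposition: `peval (substs σAT e) [t,b,c,d,u,a] = peval e [a,b,c,d,u,t]`. -/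
theorem peval_substs_σAT {R : Type*} [CommRing R] (e : Expr) (he : varsLT 6 e = true) (a b c d u t : R) :
    peval (substs σAT e) [t, b, c, d, u, a] = peval e [a, b, c, d, u, t] := by
  refine peval_substs σAT 6 [t, b, c, d, u, a] [a, b, c, d, u, t] (fun k hk => ?_) e he
  interval_cases k <;> rfl

/-- Substituting expressions with variables `< N` keeps all variables `< N`. -/
theorem varsLT_substs_of (σ : ℕ → Expr) (N : ℕ) (hσ : ∀ i, i < N → varsLT N (σ i) = true) :
    ∀ e : Expr, varsLT N e = true → varsLT N (substs σ e) = true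
  | .num _, _ => rfl
  | .natCast _, _ => rfl
  | .intCast _, _ => rfl
  | .var i, hv => by
      simp only [varsLT, decide_eq_true_eq] at hv
      exact hσ i hv
  | .neg a, hv => by simp only [varsLT] at hv; exact varsLT_substs_of σ N hσ a hv
  | .add a b, hv => by
      simp only [varsLT, Bool.and_eq_true] at hv
      simp only [substs, varsLT, Bool.and_eq_true]
      exact ⟨varsLT_substs_of σ N hσ a hv.1, varsLT_substs_of σ N hσ b hv.2⟩
  | .sub a b, hv => by
      simp only [varsLT, Bool.and_eq_true] at hv
      simp only [substs, varsLT, Bool.and_eq_true]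
      exact ⟨varsLT_substs_of σ N hσ a hv.1, varsLT_substs_of σ N hσ b hv.2⟩
  | .mul a b, hv => by
      simp only [varsLT, Bool.and_eq_true] at hv
      simp only [substs, varsLT, Bool.and_eq_true]
      exact ⟨varsLT_substs_of σ N hσ a hv.1, varsLT_substs_of σ N hσ b hv.2⟩
  | .pow a k, hv => by simp only [varsLT] at hv; exact varsLT_substs_of σ N hσ a hv

/-- The images of `σAT` have variables `< 6`. -/
theorem σAT_vars (i : ℕ) (hi : i < 6) : varsLT 6 (σAT i) = true := by
  unfold σAT
  split_ifs with h0 h5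
  · rfl
  · rfl
  · simp [varsLT, hi]

/-- The images of `σT j` have variables `< 6`. -/
theorem σT_vars (j : ℤ) (i : ℕ) (hi : i < 6) : varsLT 6 (σT j i) = true := by
  unfold σT
  split_ifs with h5
  · rfl
  · simp [varsLT, hi]

/-- **Kernel identity test with `t ↦ v₀` (largest stride) and slicing in `a ↦ v₅`**: from `varsLT 6 e`, the degree bound
`degB 5 (substs σAT e) ≤ D` and the `D+1` Kronecker vanishings of the `a`-specialisations of the permuted expression, conclude
`peval e [a,b,c,d,u,t] = 0` in every commutative ring. -/
theorem peval_eq_zero_of_kron6_perm_slices {R : Type*} [CommRing R] (e : Expr) (hv : varsLT 6 e = true) (D : ℕ)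
    (hD : degB 5 (substs σAT e) ≤ D)
    (hs : ∀ j : ℕ, j ≤ D → peval (substs (σT j) (substs σAT e)) (kronPoint6 (substs (σT j) (substs σAT e))) = 0)
    (a b c d u t : R) : peval e [a, b, c, d, u, t] = 0 := by
  have hv' : varsLT 6 (substs σAT e) = true := varsLT_substs_of σAT 6 σAT_vars e hv
  have hvs : ∀ j : ℕ, j ≤ D → varsLT 6 (substs (σT j) (substs σAT e)) = true :=
    fun j _ => varsLT_substs_of (σT j) 6 (σT_vars j) _ hv'
  have h := peval_eq_zero_of_kron6_slices (substs σAT e) hv' D hD hvs hs t b c d u a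
  rwa [peval_substs_σAT e hv] at h

/-! ### Smoke test -/

/-- `(v₀ + v₅)² = v₀² + 2v₀v₅ + v₅²` checked with `v₀ ↔ v₅` swapped and three slices. -/
example (a t : ℚ) : (a + t) ^ 2 - a ^ 2 - 2 * a * t - t ^ 2 = 0 := by
  let e : Expr := .sub (.sub (.sub (.pow (.add (.var 0) (.var 5)) 2) (.pow (.var 0) 2))
    (.mul (.mul (.num 2) (.var 0)) (.var 5))) (.pow (.var 5) 2)
  have h := peval_eq_zero_of_kron6_perm_slices e (by decide +kernel) 2 (by decide +kernel)
    (by intro j hj; interval_cases j <;> decide +kernel) a 0 0 0 0 t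
  have d0 : pvar [a, (0:ℚ), 0, 0, 0, t] 0 = a := rfl
  have d5 : pvar [a, (0:ℚ), 0, 0, 0, t] 5 = t := rfl
  simp only [e, peval_sub, peval_pow, peval_add, peval_mul, peval_num, peval_var, d0, d5] at h
  push_cast at h
  linear_combination h

end PolyReflect

end Summit.KontsevichZagierPeriods.Zeta5Search.Certificates
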